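import Literature.Probability.Percolation.TriCollarLevel
import Literature.Probability.Percolation.TriMarkedSandwich
import Literature.Probability.Percolation.CardyFormula
import HarnessLib

/-!
# The sandwich (19) at a fixed level

Topic `Literature/Probability/Percolation`; family `crit-perc`. The level-`ε` marked inner
approximations `G⁻` of the "longer, thinner" collar domain (`σ = σm`) and `G⁺` of the "shorter,
fatter" one (`σ = σp`) of a conformal rectangle `R` with anticlockwise boundary satisfy
Bollobás–Riordan's (19) (*Percolation* (2006), Ch. 7, Lemma 14 p. 184 with Claim 20 p. 192):
`P(G⁻ crossed) ≤ P_δ(Ω; A₁, A₃) + ε` and `P_δ(Ω; A₁, A₃) ≤ P(G⁺ crossed) + ε` for all small `δ`,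
together with the other level-`ε` properties of `level_core` (`level_m`, `level_p`). The corner
terms of `TriMarkedSandwich.lean` are made `≤ ε/8` each by Lemma 4
(`tri_annulusCrossing_bound_holds`) with a corner radius `ρ(ε)`.

## References

* B. Bollobás, O. Riordan, *Percolation*, Cambridge University Press (2006), Ch. 7 Lemma 14
  p. 184, Claim 20 p. 192, Lemma 4 p. 166.

## Mathlib / tree

Tree: `TriCollarLevel` (`level_core`), `TriMarkedSandwich`, `TriAnnulusCrossingProofs`
(`tri_annulusCrossing_bound_holds`), `CardyFormula` (`triDomainCrossingProb`),
`MarkedDomainCorners` (`exists_pos_le_infDist_pt_arc`, `pt_mem_arc_iff`).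
-/

noncomputable section

open Set Metric Filter Topology MeasureTheory Literature.Probability.LatticeModels Literature.Probability.RandomPlanarGeometry

namespace Literature.Probability.Percolation

variable (R : ConformalRectangle) (T : R.toJordanDomain.TubeData)

/-- **Corner radius**: given the annulus exponent `α > 0`, an outer radius `r₂ > 0` and `ε > 0`,
there is `ρ ∈ (0, min ε (r₂/2)]` with `4 (ρ/r₂)^α ≤ ε/2`. [folklore] -/
theorem exists_corner_radius {α r₂ ε : ℝ} (hα : 0 < α) (hr₂ : 0 < r₂) (hε : 0 < ε) :
    ∃ ρ > 0, ρ ≤ ε ∧ 2 * ρ ≤ r₂ ∧ 4 * (ρ / r₂) ^ α ≤ ε / 2 := by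
  set c := (ε / 8) ^ α⁻¹ with hc
  have hc0 : 0 < c := Real.rpow_pos_of_pos (by positivity) _
  have hρ2 : min (min ε (r₂ / 2)) (r₂ * c) ≤ r₂ / 2 := (min_le_left _ _).trans (min_le_right _ _)
  refine ⟨min (min ε (r₂ / 2)) (r₂ * c), by positivity, (min_le_left _ _).trans (min_le_left _ _), by linarith, ?_⟩
  have h1 : min (min ε (r₂ / 2)) (r₂ * c) / r₂ ≤ c := by
    rw [div_le_iff₀ hr₂, mul_comm]; exact min_le_right _ _
  have h2 : (min (min ε (r₂ / 2)) (r₂ * c) / r₂) ^ α ≤ c ^ α := Real.rpow_le_rpow (by positivity) h1 hα.le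
  rw [hc, Real.rpow_inv_rpow (by positivity) hα.ne'] at h2
  linarith

/-- The pushed-out arcs of `σm` are `0` and `2`. [folklore] -/
theorem σm_eq_one_iff {i : Fin 4} : σm i = 1 ↔ i = 0 ∨ i = 2 := by
  fin_cases i <;> norm_num [σm] <;> decide

/-- The pushed-out arcs of `σp` are `1` and `3`. [folklore] -/
theorem σp_eq_one_iff {i : Fin 4} : σp i = 1 ↔ i = 1 ∨ i = 3 := by
  fin_cases i <;> norm_num [σp] <;> decide

/-- A sum of four terms each `≤ c` is `≤ 4c`. [folklore] -/
theorem sum_fin_four_le {f : Fin 4 → ℝ} {c : ℝ} (h : ∀ i, f i ≤ c) : ∑ i, f i ≤ 4 * c := by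
  rw [Fin.sum_univ_four]; linarith [h 0, h 1, h 2, h 3]

/-- **Level `ε`, lower half.** For `R` with boundary of index `1` and `ε > 0`: a width `h ≤ ε` of the
"longer, thinner" collar domain (containing the centre) and `δ₀ > 0` such that for every
`δ < δ₀` the level-`ε` marked inner approximation `G⁻` has arcs mutually within `2ε` of the arcs of
`R`, fills `Φ(B̄(0, 1 - 2ε))`, has face centres `2ε`-dense in `closure Ω`, and
`P(G⁻ has an open crossing from arc 0 to arc 2) ≤ P_δ(Ω; A₁, A₃) + ε`.
[cite: BollobasRiordan2006, Ch. 7 Lemma 14 (19) p. 184, Claim 20 p. 192] -/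
theorem level_m (hR1 : ∀ z ∈ R.carrier, R.index z = 1) {ε : ℝ} (hε : 0 < ε) :
    ∃ (h : ℝ) (hh : 0 < h) (hh1 : h ≤ 1 / 2), h ≤ ε ∧
      T.z₀ ∈ (R.collarRect T (MarkedDomain.abs_le_one_of_sign σm_sign) hh hh1).carrier ∧
      ∃ δ₀ > 0, ∀ δ : ℝ, ∀ hδ : 0 < δ, δ < δ₀ →
        ∃ hc₀ : baseSite T.z₀ δ ∈ innerCoarse (R.collarRect T (MarkedDomain.abs_le_one_of_sign σm_sign) hh hh1).carrier δ,
        ∃ G : TriMarkedDomain 4,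
          G.verts = (innerApprox (R.collarRect T (MarkedDomain.abs_le_one_of_sign σm_sign) hh hh1).toJordanDomain hδ hc₀).verts ∧
          (∀ i : Fin 4, (∀ y ∈ G.arc i, ∃ z ∈ R.arc i, dist (triMeshPoint δ y) z < 2 * ε) ∧
            ∀ z ∈ R.arc i, ∃ y ∈ G.arc i, dist (triMeshPoint δ y) z < 2 * ε) ∧
          (∀ x : Site 2, triMeshPoint δ x ∈ T.Ci.Φ '' closedBall (0 : ℂ) (1 - 2 * ε) → x ∈ G.verts) ∧
          (∀ z ∈ closure R.carrier, ∃ w ∈ G.faces, dist z ((δ : ℂ) * hexCenter w) < 2 * ε) ∧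
          G.openCrossingProb 0 2 ≤ triDomainCrossingProb R δ + ε := by
  classical
  obtain ⟨carc, hcarc0, hcarc⟩ := R.exists_pos_le_infDist_pt_arc
  obtain ⟨α, hα, hbound⟩ := tri_annulusCrossing_bound_holds
  -- work at level `ε' = min ε (carc/4)`
  set ε' := min ε (carc / 4) with hε'
  have hε'0 : 0 < ε' := lt_min hε (by linarith)
  have hε'ε : ε' ≤ ε := min_le_left _ _
  have hε'c : ε' ≤ carc / 4 := min_le_right _ _
  set r₂ := carc / 3 with hr₂
  obtain ⟨ρ, hρ, hρε, hρr, hρα⟩ := exists_corner_radius (r₂ := r₂) hα (by positivity) hε'0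
  obtain ⟨δS, hδS, t₀, ht₀, hsand⟩ := openCrossingProb_le_triCrossingProb_add R
  obtain ⟨h, hh, hh1, hhε, hz₀, δ₀, hδ₀, t, ht0, htt₀, hlev⟩ := level_core R T σm_sign hR1 hε'0 hρ ht₀ hcarc
  refine ⟨h, hh, hh1, hhε.trans hε'ε, hz₀, min δ₀ (min δS (ρ / 1000)), by positivity, fun δ hδ hδlt => ?_⟩
  have hδ₀' : δ < δ₀ := hδlt.trans_le (min_le_left _ _)
  have hδS' : δ < δS := hδlt.trans_le ((min_le_right _ _).trans (min_le_left _ _))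
  have hδρ : δ < ρ / 1000 := hδlt.trans_le ((min_le_right _ _).trans (min_le_right _ _))
  obtain ⟨hc₀, G, hGv, harcs, H1, H2, H3, H4, hfill, hdense⟩ := hlev δ hδ hδ₀'
  refine ⟨hc₀, G, hGv, fun i => ⟨fun y hy => ?_, fun z hz => ?_⟩, fun x hx => hfill x ?_, fun z hz => ?_, ?_⟩
  · obtain ⟨z, hz, hd⟩ := (harcs i).1 y hy; exact ⟨z, hz, by linarith⟩
  · obtain ⟨y, hy, hd⟩ := (harcs i).2 z hz; exact ⟨y, hy, by linarith⟩
  · obtain ⟨u, hu, hux⟩ := hx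
    exact ⟨u, closedBall_subset_closedBall (by linarith) hu, hux⟩
  · obtain ⟨w, hw, hd⟩ := hdense z hz; exact ⟨w, hw, by linarith⟩
  -- the sandwich
  have hσ0 : σm 0 = 1 := by simp [σm]
  have hσ2 : σm 2 = 1 := by simp [σm]
  have hσ1' : σm 1 = -1 := by simp [σm]
  have hσ3 : σm 3 = -1 := by simp [σm]
  have key := hsand δ t hδ hδS' ht0 htt₀ (ρ := ρ) (r₁ := ρ) (r₂ := r₂) le_rfl G
    (fun x hx hxΩ => by
      obtain ⟨i, hi, hd⟩ := H1 x hx hxΩ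
      rcases σm_eq_one_iff.1 hi with rfl | rfl
      · exact Or.inl hd
      · exact Or.inr hd)
    (fun x hx hxΩ hfar => ⟨H2 x hx hxΩ hfar 1 hσ1', H2 x hx hxΩ hfar 3 hσ3⟩)
    (fun u hu hfar => H3 0 hσ0 u hu hfar) (fun v hv hfar => H3 2 hσ2 v hv hfar)
    (fun u hu => ⟨by linarith [H4 0 u hu 2 (by rw [R.pt_mem_arc_iff]; decide)],
      by linarith [H4 0 u hu 3 (by rw [R.pt_mem_arc_iff]; decide)]⟩)
    (fun v hv => ⟨by linarith [H4 2 v hv 0 (by rw [R.pt_mem_arc_iff]; decide)],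
      by linarith [H4 2 v hv 1 (by rw [R.pt_mem_arc_iff]; decide)]⟩)
  have hcorner : ∀ i : Fin 4, (triSitePercolation half).real (triAnnulusCrossing true δ (R.pt i) ρ r₂) ≤ (ρ / r₂) ^ α :=
    fun i => hbound true δ (R.pt i) ρ r₂ hδ (by linarith) hρr
  have hsum := sum_fin_four_le hcorner
  show G.openCrossingProb 0 2 ≤ triCrossingProb R.carrier δ (R.arc 0) (R.arc 2) half + ε
  linarith

/-- **Level `ε`, upper half.** The same for the "shorter, fatter" collar domain and
`P_δ(Ω; A₁, A₃) ≤ P(G⁺ has an open crossing from arc 0 to arc 2) + ε` (through Lemma 5).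
[cite: BollobasRiordan2006, Ch. 7 Lemma 14 (19) p. 184, Claim 20 p. 192, Lemma 5] -/
theorem level_p (hR1 : ∀ z ∈ R.carrier, R.index z = 1) {ε : ℝ} (hε : 0 < ε) :
    ∃ (h : ℝ) (hh : 0 < h) (hh1 : h ≤ 1 / 2), h ≤ ε ∧
      T.z₀ ∈ (R.collarRect T (MarkedDomain.abs_le_one_of_sign σp_sign) hh hh1).carrier ∧
      ∃ δ₀ > 0, ∀ δ : ℝ, ∀ hδ : 0 < δ, δ < δ₀ →
        ∃ hc₀ : baseSite T.z₀ δ ∈ innerCoarse (R.collarRect T (MarkedDomain.abs_le_one_of_sign σp_sign) hh hh1).carrier δ,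
        ∃ G : TriMarkedDomain 4,
          G.verts = (innerApprox (R.collarRect T (MarkedDomain.abs_le_one_of_sign σp_sign) hh hh1).toJordanDomain hδ hc₀).verts ∧
          (∀ i : Fin 4, (∀ y ∈ G.arc i, ∃ z ∈ R.arc i, dist (triMeshPoint δ y) z < 2 * ε) ∧
            ∀ z ∈ R.arc i, ∃ y ∈ G.arc i, dist (triMeshPoint δ y) z < 2 * ε) ∧
          (∀ x : Site 2, triMeshPoint δ x ∈ T.Ci.Φ '' closedBall (0 : ℂ) (1 - 2 * ε) → x ∈ G.verts) ∧
          (∀ z ∈ closure R.carrier, ∃ w ∈ G.faces, dist z ((δ : ℂ) * hexCenter w) < 2 * ε) ∧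
          triDomainCrossingProb R δ ≤ G.openCrossingProb 0 2 + ε := by
  classical
  obtain ⟨carc, hcarc0, hcarc⟩ := R.exists_pos_le_infDist_pt_arc
  obtain ⟨α, hα, hbound⟩ := tri_annulusCrossing_bound_holds
  set ε' := min ε (carc / 4) with hε'
  have hε'0 : 0 < ε' := lt_min hε (by linarith)
  have hε'ε : ε' ≤ ε := min_le_left _ _
  have hε'c : ε' ≤ carc / 4 := min_le_right _ _
  set r₂ := carc / 3 with hr₂
  obtain ⟨ρ, hρ, hρε, hρr, hρα⟩ := exists_corner_radius (r₂ := r₂) hα (by positivity) hε'0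
  obtain ⟨δS, hδS, t₀, ht₀, hsand⟩ := triCrossingProb_le_openCrossingProb_add R hρ
  obtain ⟨h, hh, hh1, hhε, hz₀, δ₀, hδ₀, t, ht0, htt₀, hlev⟩ := level_core R T σp_sign hR1 hε'0 hρ ht₀ hcarc
  refine ⟨h, hh, hh1, hhε.trans hε'ε, hz₀, min δ₀ (min δS (ρ / 1000)), by positivity, fun δ hδ hδlt => ?_⟩
  have hδ₀' : δ < δ₀ := hδlt.trans_le (min_le_left _ _)
  have hδS' : δ < δS := hδlt.trans_le ((min_le_right _ _).trans (min_le_left _ _))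
  have hδρ : δ < ρ / 1000 := hδlt.trans_le ((min_le_right _ _).trans (min_le_right _ _))
  obtain ⟨hc₀, G, hGv, harcs, H1, H2, H3, H4, hfill, hdense⟩ := hlev δ hδ hδ₀'
  refine ⟨hc₀, G, hGv, fun i => ⟨fun y hy => ?_, fun z hz => ?_⟩, fun x hx => hfill x ?_, fun z hz => ?_, ?_⟩
  · obtain ⟨z, hz, hd⟩ := (harcs i).1 y hy; exact ⟨z, hz, by linarith⟩
  · obtain ⟨y, hy, hd⟩ := (harcs i).2 z hz; exact ⟨y, hy, by linarith⟩
  · obtain ⟨u, hu, hux⟩ := hx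
    exact ⟨u, closedBall_subset_closedBall (by linarith) hu, hux⟩
  · obtain ⟨w, hw, hd⟩ := hdense z hz; exact ⟨w, hw, by linarith⟩
  have hσ1 : σp 1 = 1 := by simp [σp]
  have hσ3 : σp 3 = 1 := by simp [σp]
  have hσ0 : σp 0 = -1 := by simp [σp]
  have hσ2 : σp 2 = -1 := by simp [σp]
  have key := hsand δ t hδ hδS' ht0 htt₀ (r₁ := ρ) (r₂ := r₂) le_rfl G
    (fun x hx hxΩ => by
      obtain ⟨i, hi, hd⟩ := H1 x hx hxΩ
      rcases σp_eq_one_iff.1 hi with rfl | rfl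
      · exact Or.inl hd
      · exact Or.inr hd)
    (fun x hx hxΩ hfar => ⟨H2 x hx hxΩ hfar 0 hσ0, H2 x hx hxΩ hfar 2 hσ2⟩)
    (fun u hu hfar => H3 1 hσ1 u hu hfar) (fun v hv hfar => H3 3 hσ3 v hv hfar)
    (fun u hu => ⟨by linarith [H4 1 u hu 3 (by rw [R.pt_mem_arc_iff]; decide)],
      by linarith [H4 1 u hu 0 (by rw [R.pt_mem_arc_iff]; decide)]⟩)
    (fun v hv => ⟨by linarith [H4 3 v hv 1 (by rw [R.pt_mem_arc_iff]; decide)],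
      by linarith [H4 3 v hv 2 (by rw [R.pt_mem_arc_iff]; decide)]⟩)
  have hcorner : ∀ i : Fin 4, (triSitePercolation half).real (triAnnulusCrossing false δ (R.pt i) ρ r₂) ≤ (ρ / r₂) ^ α :=
    fun i => hbound false δ (R.pt i) ρ r₂ hδ (by linarith) hρr
  have hsum := sum_fin_four_le hcorner
  show triCrossingProb R.carrier δ (R.arc 0) (R.arc 2) half ≤ G.openCrossingProb 0 2 + ε
  linarith

end Literature.Probability.Percolation
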